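import Literature.NumberTheory.GaloisRepresentations.ConjugationDescent
import Literature.NumberTheory.EllipticCurves.IwasawaDualModuleTwoVar
import HarnessLib

/-!
# The `G/N`-action on `H¹(N, X)` and `H²(N, X)` makes the finite levels `ℤ_p⟦T₁,T₂⟧`-modules:
# `T_i ↦ conj_{γ_i} − 1` is a commuting, locally nilpotent pair (`IsLocNil₂`) on a `p`-power-torsion level

Topic `NumberTheory/GaloisRepresentations`; namespace `Literature.NumberTheory.GaloisRepresentations`.
One transparent definition (`conjEnd`, the action as an element of `AddMonoid.End`, so that powers and
`IsLocNil₂` can be stated) and theorems; no named fact, no instance.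

For a topological group `G`, a normal subgroup `N` and a topological `G`-module `X`, the tree's
`conjMap X N g n : Hⁿ(N, X) → Hⁿ(N, X)` (`ContinuousCorestriction.lean`) is the action of `g ∈ G`; elements of
`N` act trivially in degrees `1, 2` (`ConjugationDescent.lean`: `conjMap_eq_self_of_mem_one/two`, Serre,
*Corps locaux* VII §5 Prop. 3) and `conjMap h ∘ conjMap g = conjMap (hg)` (`conjMap_conjMap`).  This file
draws the two consequences that let the completed group ring `Λ₂ = ℤ_p⟦T₁,T₂⟧` act on the levels of an
Iwasawa-cohomology tower `lim←_{n,k} Hⁱ(G_S(K_n), M_k)` through `T_i ↦ conj_{γ_i} − 1` (Lang, *Cyclotomic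
Fields* Ch. 5 §1: `Λ` as the limit of the group rings of the finite layers; Johnson-Leung–Kings 2011 Def. 4.2
/ Kato 2004 §8.2: `Hⁱ(𝒪_K[1/p], Λ(χ)(1)) = lim← Hⁱ(𝒪_{K_n}[1/p], ℤ/p^k(χ)(1))`):

* `conjEnd X N g n : AddMonoid.End (Hⁿ(N, X))` — `conjMap X N g n` as an additive endomorphism (`conjEnd_apply`);
* `conjMap_comm_of_commutator_mem_one/two` — **if `[γ₁, γ₂] ∈ N` the operators `conj_{γ₁}`, `conj_{γ₂}`
  COMMUTE on `H¹(N, X)`, `H²(N, X)`** (they differ by `conj` of an element of `N`);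
* `conjEnd_pow_apply_one/two` — `(conj_γ)^k = conj_{γ^k}`; `conjEnd_pow_apply_eq_self_of_pow_mem_one/two` —
  **`(conj_γ)^{m} = 1` once `γ^{m} ∈ N`**;
* ★ `isLocNil₂_conjEnd_sub_one_one/two` — **on a level killed by `p^e`, with `γ_i^{p^{m_i}} ∈ N` and
  `[γ₁, γ₂] ∈ N`, the pair `(conj_{γ₁} − 1, conj_{γ₂} − 1)` satisfies the tree's `IwasawaDual.IsLocNil₂ p`** —
  so `IsLocNil₂.selfModule` makes `Hⁱ(N, X)` (`i = 1, 2`) a `ℤ_p⟦T₁,T₂⟧`-module with `T_i ↦ conj_{γ_i} − 1`, and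
  `IwasawaDual.invLimitGen` assembles the doubly-indexed inverse limits (the construction behind the pinned
  carriers of the two-variable Iwasawa cohomology; cf. the one-variable `Kato2004.nonempty_iwasawaH1DataOver`).

## References
* J.-P. Serre, *Corps locaux* (1968) / *Local Fields* (1979), VII §5 Prop. 3. [SerreLocalFields1979]
* S. Lang, *Cyclotomic Fields I and II* (1990), Ch. 5 §1. [Lang1990]
* R. Greenberg, LNM 1716 (1999), §1 (after Conj. 1.3): local nilpotence of `γ − 1`. [GreenbergLNM1716]
-/

noncomputable section

open CategoryTheory Function

universe u v

namespace Literature.NumberTheory.GaloisRepresentations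

open Literature.NumberTheory.EllipticCurves.IwasawaDual

variable {R : Type u} [CommRing R] [TopologicalSpace R]
variable {G : Type v} [Group G] [TopologicalSpace G] [IsTopologicalGroup G]
variable (X : TopRep.{v} R G) (N : Subgroup G) [N.Normal]

/-- **The action of `g ∈ G` on `Hⁿ(N, X)` as an additive endomorphism** (the tree's `conjMap X N g n`, a morphism
of topological modules, read in `AddMonoid.End` so that its powers and the `IsLocNil₂` packaging can be
written). [cite: SerreLocalFields1979, VII §5] -/
abbrev conjEnd (g : G) (n : ℕ) : AddMonoid.End (continuousCohomology n (subgroupRep X N)) :=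
  (conjMap X N g n).hom.toLinearMap.toAddMonoidHom

/-- Unfolding `conjEnd`. [cite: SerreLocalFields1979, VII §5] -/
@[simp] theorem conjEnd_apply (g : G) (n : ℕ) (y : continuousCohomology n (subgroupRep X N)) :
    conjEnd X N g n y = conjMap X N g n y := rfl

/-- `conjEnd (hg) = conjEnd h * conjEnd g` (all degrees). [cite: SerreLocalFields1979, VII §5] -/
theorem conjEnd_mul (g h : G) (n : ℕ) : conjEnd X N (h * g) n = conjEnd X N h n * conjEnd X N g n :=
  AddMonoidHom.ext fun y ↦ (conjMap_conjMap X N g h n y).symm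

/-! ### Degree one -/

section One

/-- **Commuting modulo `N` ⟹ commuting on `H¹(N, X)`**: if the commutator `γ₁ γ₂ γ₁⁻¹ γ₂⁻¹` lies in `N`,
then `conj_{γ₁} ∘ conj_{γ₂} = conj_{γ₂} ∘ conj_{γ₁}` on `H¹(N, X)` (elements of `N` act trivially).
[cite: SerreLocalFields1979, VII §5 Prop. 3] -/
theorem conjMap_comm_of_commutator_mem_one {γ₁ γ₂ : G} (hc : γ₁ * γ₂ * γ₁⁻¹ * γ₂⁻¹ ∈ N)
    (y : continuousCohomology 1 (subgroupRep X N)) :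
    conjMap X N γ₁ 1 (conjMap X N γ₂ 1 y) = conjMap X N γ₂ 1 (conjMap X N γ₁ 1 y) := by
  rw [conjMap_conjMap, conjMap_conjMap,
    show γ₁ * γ₂ = (γ₁ * γ₂ * γ₁⁻¹ * γ₂⁻¹) * (γ₂ * γ₁) by group, ← conjMap_conjMap,
    conjMap_eq_self_of_mem_one X N hc]

/-- Powers of the additive operator `conj_γ` on `H¹(N, X)` are `conj_{γ^k}`. [cite: SerreLocalFields1979, VII §5] -/
theorem conjEnd_pow_apply_one (γ : G) (k : ℕ) (y : continuousCohomology 1 (subgroupRep X N)) :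
    (conjEnd X N γ 1 ^ k) y = conjMap X N (γ ^ k) 1 y := by
  induction k generalizing y with
  | zero => rw [pow_zero, pow_zero, AddMonoid.End.one_apply, conjMap_one_one]
  | succ k ih =>
    rw [pow_succ, AddMonoid.End.coe_mul, Function.comp_apply, conjEnd_apply, pow_succ, ← conjMap_conjMap]
    exact ih _

/-- **`(conj_γ)^m = 1` on `H¹(N, X)` once `γ^m ∈ N`.** [cite: SerreLocalFields1979, VII §5 Prop. 3] -/
theorem conjEnd_pow_apply_eq_self_of_pow_mem_one {γ : G} {m : ℕ} (hγ : γ ^ m ∈ N)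
    (y : continuousCohomology 1 (subgroupRep X N)) : (conjEnd X N γ 1 ^ m) y = y := by
  rw [conjEnd_pow_apply_one, conjMap_eq_self_of_mem_one X N hγ]

/-- ★ **The level structure in degree one.** On `H¹(N, X)` killed by `p^e`, for `γ₁, γ₂ ∈ G` with
`γ_i^{p^{m_i}} ∈ N` and `γ₁γ₂γ₁⁻¹γ₂⁻¹ ∈ N`, the pair `(conj_{γ₁} − 1, conj_{γ₂} − 1)` is `IsLocNil₂ p`:
commuting, `p`-power torsion, both locally nilpotent — hence `H¹(N, X)` is a `ℤ_p⟦T₁,T₂⟧`-module with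
`T_i ↦ conj_{γ_i} − 1` (`IsLocNil₂.selfModule`), the level of the two-variable Iwasawa cohomology.
[cite: Lang1990, Ch. 5 §1] [cite: GreenbergLNM1716, §1 (after Conj. 1.3)] -/
theorem isLocNil₂_conjEnd_sub_one_one {p : ℕ} [Fact p.Prime] {γ₁ γ₂ : G} {m₁ m₂ e : ℕ}
    (h₁ : γ₁ ^ p ^ m₁ ∈ N) (h₂ : γ₂ ^ p ^ m₂ ∈ N) (hc : γ₁ * γ₂ * γ₁⁻¹ * γ₂⁻¹ ∈ N)
    (hexp : ∀ y : continuousCohomology 1 (subgroupRep X N), p ^ e • y = 0) :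
    IsLocNil₂ p (conjEnd X N γ₁ 1 - 1) (conjEnd X N γ₂ 1 - 1) where
  comm := by
    have hc' : Commute (conjEnd X N γ₁ 1) (conjEnd X N γ₂ 1) := by
      ext y
      exact conjMap_comm_of_commutator_mem_one X N hc y
    exact (hc'.sub_right (Commute.one_right _)).sub_left (Commute.one_left _)
  torsion := fun y ↦ ⟨e, hexp y⟩
  nil₁ := fun y ↦ ⟨e * p ^ m₁, pow_mul_prime_pow_apply_eq_zero (Fact.out : p.Prime) _ m₁
    (conjEnd_pow_apply_eq_self_of_pow_mem_one X N h₁ y) (hexp y)⟩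
  nil₂ := fun y ↦ ⟨e * p ^ m₂, pow_mul_prime_pow_apply_eq_zero (Fact.out : p.Prime) _ m₂
    (conjEnd_pow_apply_eq_self_of_pow_mem_one X N h₂ y) (hexp y)⟩

end One

/-! ### Degree two -/

section Two

variable [LocallyCompactSpace N]

/-- **Commuting modulo `N` ⟹ commuting on `H²(N, X)`.** [cite: SerreLocalFields1979, VII §5 Prop. 3] -/
theorem conjMap_comm_of_commutator_mem_two {γ₁ γ₂ : G} (hc : γ₁ * γ₂ * γ₁⁻¹ * γ₂⁻¹ ∈ N)
    (y : continuousCohomology 2 (subgroupRep X N)) :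
    conjMap X N γ₁ 2 (conjMap X N γ₂ 2 y) = conjMap X N γ₂ 2 (conjMap X N γ₁ 2 y) := by
  rw [conjMap_conjMap, conjMap_conjMap,
    show γ₁ * γ₂ = (γ₁ * γ₂ * γ₁⁻¹ * γ₂⁻¹) * (γ₂ * γ₁) by group, ← conjMap_conjMap,
    conjMap_eq_self_of_mem_two X N hc]

/-- Powers of the additive operator `conj_γ` on `H²(N, X)` are `conj_{γ^k}`. [cite: SerreLocalFields1979, VII §5] -/
theorem conjEnd_pow_apply_two (γ : G) (k : ℕ) (y : continuousCohomology 2 (subgroupRep X N)) :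
    (conjEnd X N γ 2 ^ k) y = conjMap X N (γ ^ k) 2 y := by
  induction k generalizing y with
  | zero => rw [pow_zero, pow_zero, AddMonoid.End.one_apply, conjMap_one_two]
  | succ k ih =>
    rw [pow_succ, AddMonoid.End.coe_mul, Function.comp_apply, conjEnd_apply, pow_succ, ← conjMap_conjMap]
    exact ih _

/-- **`(conj_γ)^m = 1` on `H²(N, X)` once `γ^m ∈ N`.** [cite: SerreLocalFields1979, VII §5 Prop. 3] -/
theorem conjEnd_pow_apply_eq_self_of_pow_mem_two {γ : G} {m : ℕ} (hγ : γ ^ m ∈ N)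
    (y : continuousCohomology 2 (subgroupRep X N)) : (conjEnd X N γ 2 ^ m) y = y := by
  rw [conjEnd_pow_apply_two, conjMap_eq_self_of_mem_two X N hγ]

/-- ★ **The level structure in degree two**: on `H²(N, X)` killed by `p^e`, with `γ_i^{p^{m_i}} ∈ N` and
`γ₁γ₂γ₁⁻¹γ₂⁻¹ ∈ N`, the pair `(conj_{γ₁} − 1, conj_{γ₂} − 1)` is `IsLocNil₂ p`.
[cite: Lang1990, Ch. 5 §1] [cite: GreenbergLNM1716, §1 (after Conj. 1.3)] -/
theorem isLocNil₂_conjEnd_sub_one_two {p : ℕ} [Fact p.Prime] {γ₁ γ₂ : G} {m₁ m₂ e : ℕ}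
    (h₁ : γ₁ ^ p ^ m₁ ∈ N) (h₂ : γ₂ ^ p ^ m₂ ∈ N) (hc : γ₁ * γ₂ * γ₁⁻¹ * γ₂⁻¹ ∈ N)
    (hexp : ∀ y : continuousCohomology 2 (subgroupRep X N), p ^ e • y = 0) :
    IsLocNil₂ p (conjEnd X N γ₁ 2 - 1) (conjEnd X N γ₂ 2 - 1) where
  comm := by
    have hc' : Commute (conjEnd X N γ₁ 2) (conjEnd X N γ₂ 2) := by
      ext y
      exact conjMap_comm_of_commutator_mem_two X N hc y
    exact (hc'.sub_right (Commute.one_right _)).sub_left (Commute.one_left _)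
  torsion := fun y ↦ ⟨e, hexp y⟩
  nil₁ := fun y ↦ ⟨e * p ^ m₁, pow_mul_prime_pow_apply_eq_zero (Fact.out : p.Prime) _ m₁
    (conjEnd_pow_apply_eq_self_of_pow_mem_two X N h₁ y) (hexp y)⟩
  nil₂ := fun y ↦ ⟨e * p ^ m₂, pow_mul_prime_pow_apply_eq_zero (Fact.out : p.Prime) _ m₂
    (conjEnd_pow_apply_eq_self_of_pow_mem_two X N h₂ y) (hexp y)⟩

end Two

end Literature.NumberTheory.GaloisRepresentations

end
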